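import Mathlib.Analysis.Matrix.PosDef
import Summits.Ventures.HSemireg.SecantParityPolarisation
import HarnessLib

/-!
# Venture HSemireg — DICTIONARY between the `g_P` model and the Hermitian matrix of `b`: in coordinates, Markman's `g_P` is
# NEGATIVE definite on real points iff the coefficient matrix `h` of `b` is POSITIVE definite (TRACK S4-PUSH (ii), seat
# `s4-prove-1`, ATTEMPT-4; leaf over `SecantParityPolarisation.lean`; files of record `s4push/prove-1/ATTEMPT-1.md` §2/§9,
# `STATEMENTS-S3INPUT.md` S3INP-3)

HONEST FRAMING. Lean index of the computation cell `pub-hsemireg`. LINEAR ALGEBRA IN COORDINATES ONLY: `E = E^{1,0} ⊕ E^{0,1} =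
(Fin g → ℂ) × (Fin g → ℂ)` with `J = (i, -i)`, real points `y = (α, ᾱ)`, and the `(1,1)`-form with Hermitian coefficient matrix `h`,
`b_h((u,w),(u',w')) = (i/2)(uᵀ h w' - u'ᵀ h w)` (i.e. `b = (i/2) Σ h_{jk} dz_j ∧ dz̄_k`).  It instantiates the abstract model of
`SecantParityPolarisation` (Markman's `V = Dual E × E`, `I_V`, `W₁`, `W₂`, `f`, `g_P`; [Mar25 §2.4]) in these coordinates.  No abelian
variety, Hodge structure or polarisation is constructed; that these coordinates ARE a holomorphic frame of `H¹(X̂, ℂ)` with `b` a real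
`(1,1)`-class of `X` is the paper dictionary (Lange 2023 §1.2/§2.1.1).  Nothing here says that HC, HC_CM or HC_AV holds.

*What it indexes (on paper).* ATTEMPT-1 §2 / S3INP-3: `(X × X̂, η_P, Ξ_P)` is a POLARISED abelian variety of Weil type (Markman:
`g_P` negative definite, Prop. 2.4.4 for `B = √-d·Θ`, `Θ` ample) iff `b` is a polarisation of `X` (its Hermitian form positive definite).
KERNEL HERE: **`bForm_realPt_J`** — `b_h(y, Jy) = v̄ᵀ h v` at the real point `y = (v̄, v)`; **`posDef_iff_bForm_realPt_pos`** — `h`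
positive definite iff `b_h(y, Jy) > 0` at every non-zero real point; **`gP_realPt_eq`** — in the model of `SecantParityPolarisation`
with `b = b_h`, `a = b_{h'}` (any coefficient matrix, the real part drops out), `B = a + t b`, `B̄ = a - t b`, `t² = -d`: at the real point
built from `y = a' + i b'`, `a' = (ᾱ₁… )`, Markman's `(f I_V x, x)_V = -4d·(v̄₁ᵀ h v₁ + v̄₂ᵀ h v₂)`; **`gP_realPt_neg_of_posDef`** — hence
for `h` positive definite and `d > 0` it is NEGATIVE at every non-zero real point: `g_P` negative definite, Markman's sign, for EVERY
polarisation-type exponent — and conversely `negDef ⇒ PosDef` (`posDef_of_gP_realPt_neg`).  Composed with `SecantParityPositivity`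
(`β_hᵍ = det h • ω₀ᵍ`, `det h > 0`) this is the kernel form of «polarising secant plane ⇒ (H1)» modulo the two model identifications.

CONTENT (all PROVED, 0 sorry; definitions with bodies `J`, `realPt`, `bForm`; no named facts), namespace
`Summit.Ventures.HSemireg.SecantParity.Dictionary`.

## References

* [Markman2025SecantWeil] E. Markman, arXiv:2502.03415 (UNREFEREED), §2.4 Lemma 2.4.2, Prop. 2.4.4.
* [Lange2023AbelianVarietiesComplex] H. Lange, Abelian Varieties over the Complex Numbers (2023), §1.2, §2.1.1 (positive line bundles).
-/

noncomputable section

namespace Summit.Ventures.HSemireg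

namespace SecantParity

namespace Dictionary

open scoped ComplexOrder
open Matrix
open Summit.Ventures.HSemireg.SecantParity.Polarisation (pairV IV x₁ gP_eq_realPoint)

variable {g : ℕ}

/-- The coordinate carrier `E = E^{1,0} ⊕ E^{0,1}`. [cite: Markman2025SecantWeil, §2.4 Lemma «decomposition into four direct summands»] -/
abbrev E (g : ℕ) := (Fin g → ℂ) × (Fin g → ℂ)

/-- `J = i` on `E^{1,0}`, `-i` on `E^{0,1}`. [cite: Markman2025SecantWeil, §2.4 Lemma 2.4.2] -/
def J : E g →ₗ[ℂ] E g := LinearMap.prodMap (Complex.I • LinearMap.id) (-(Complex.I • LinearMap.id))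

/-- `J` componentwise. [folklore] -/
theorem J_apply (y : E g) : J y = (Complex.I • y.1, -(Complex.I • y.2)) := rfl

/-- `J² = -1`. [folklore] -/
theorem J_J (y : E g) : J (J y) = -y := by
  ext i <;> simp [J_apply, smul_smul, Complex.I_mul_I]

/-- The real points `y = (α, ᾱ)` (fixed by the conjugation swapping the two types). [cite: Markman2025SecantWeil, §2.4 Lemma 2.4.2] -/
def realPt (α : Fin g → ℂ) : E g := (α, star α)

/-- **The `(1,1)`-form with Hermitian coefficient matrix `h`**: `b_h((u,w),(u',w')) = (i/2)(uᵀ h w' - u'ᵀ h w)`, i.e.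
`b = (i/2) Σ_{j,k} h_{jk} dz_j ∧ dz̄_k`. [cite: Lange2023AbelianVarietiesComplex, §1.7 Lemma 1.7.4] -/
def bForm (h : Matrix (Fin g) (Fin g) ℂ) : E g →ₗ[ℂ] E g →ₗ[ℂ] ℂ :=
  LinearMap.mk₂ ℂ (fun y y' ↦ (Complex.I / 2) * (y.1 ⬝ᵥ (h *ᵥ y'.2) - y'.1 ⬝ᵥ (h *ᵥ y.2)))
    (fun y₁ y₂ y' ↦ by simp only [Prod.fst_add, Prod.snd_add, add_dotProduct, mulVec_add, dotProduct_add]; ring)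
    (fun c y y' ↦ by simp only [Prod.smul_fst, Prod.smul_snd, smul_dotProduct, mulVec_smul, dotProduct_smul, smul_eq_mul]; ring)
    (fun y y₁ y₂ ↦ by simp only [Prod.fst_add, Prod.snd_add, add_dotProduct, mulVec_add, dotProduct_add]; ring)
    (fun c y y' ↦ by simp only [Prod.smul_fst, Prod.smul_snd, smul_dotProduct, mulVec_smul, dotProduct_smul, smul_eq_mul]; ring)

/-- `b_h` on arguments. [folklore] -/
theorem bForm_apply (h : Matrix (Fin g) (Fin g) ℂ) (y y' : E g) :
    bForm h y y' = (Complex.I / 2) * (y.1 ⬝ᵥ (h *ᵥ y'.2) - y'.1 ⬝ᵥ (h *ᵥ y.2)) := rfl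

/-- `b_h` is alternating. [folklore] -/
theorem bForm_alt (h : Matrix (Fin g) (Fin g) ℂ) (y y' : E g) : bForm h y y' = -bForm h y' y := by
  rw [bForm_apply, bForm_apply]; ring

/-- `b_h` is `J`-invariant (type `(1,1)`). [cite: Lange2023AbelianVarietiesComplex, §1.2] -/
theorem bForm_J (h : Matrix (Fin g) (Fin g) ℂ) (y y' : E g) : bForm h (J y) (J y') = bForm h y y' := by
  simp only [bForm_apply, J_apply, smul_dotProduct, mulVec_neg, mulVec_smul, dotProduct_neg, dotProduct_smul, smul_eq_mul]
  linear_combination (y'.1 ⬝ᵥ (h *ᵥ y.2) - y.1 ⬝ᵥ (h *ᵥ y'.2)) * (Complex.I / 2) * Complex.I_sq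

/-- **`b_h(y, J y) = v̄ᵀ h v` at the real point `y = (v̄, v)`** (`v = ᾱ`): the real quadratic form of the W-coordinate formula is the
Hermitian form of `h`. [cite: Lange2023AbelianVarietiesComplex, §2.1.1] -/
theorem bForm_realPt_J (h : Matrix (Fin g) (Fin g) ℂ) (α : Fin g → ℂ) :
    bForm h (realPt α) (J (realPt α)) = star (star α) ⬝ᵥ (h *ᵥ star α) := by
  simp only [bForm_apply, realPt, J_apply, mulVec_neg, mulVec_smul, dotProduct_neg, dotProduct_smul, smul_dotProduct,
    smul_eq_mul, star_star]
  linear_combination (-(α ⬝ᵥ (h *ᵥ star α))) * Complex.I_sq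

/-- **Dictionary**: `h` positive definite ⟺ `b_h(y, J y) > 0` at every non-zero real point (given `h` Hermitian).
[cite: Lange2023AbelianVarietiesComplex, §2.1.1] -/
theorem posDef_iff_bForm_realPt_pos {h : Matrix (Fin g) (Fin g) ℂ} (hh : h.IsHermitian) :
    h.PosDef ↔ ∀ α : Fin g → ℂ, α ≠ 0 → 0 < bForm h (realPt α) (J (realPt α)) := by
  rw [posDef_iff_dotProduct_mulVec]
  constructor
  · rintro ⟨-, hpos⟩ α hα
    rw [bForm_realPt_J]
    exact hpos (fun h0 ↦ hα (star_eq_zero.mp h0))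
  · intro hpos
    refine ⟨hh, fun x hx ↦ ?_⟩
    have h1 := hpos (star x) (fun h0 ↦ hx (star_eq_zero.mp h0))
    simpa only [bForm_realPt_J, star_star] using h1

/-- **Markman's `g_P` at a real point, in coordinates**: in the model of `SecantParityPolarisation` with `b = b_h`, real part
`a = b_{h'}` (ANY coefficient matrix — it drops out), `B = a + t·b`, `B̄ = a - t·b`, `t² = -d`, `f = ±t` on `W₁/W₂`: for the real
point built from `a' = (ᾱ₁, α₁)`, `b' = (ᾱ₂, α₂)`,
`(f I_V x, x)_V = -4d·(ᾱ₁ᵀ h α₁ + ᾱ₂ᵀ h α₂)` … precisely `-4d·(star(star α₁) ⬝ h (star α₁) + star(star α₂) ⬝ h (star α₂))`.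
[cite: Markman2025SecantWeil, §2.4 Prop. 2.4.4 and its proof] -/
theorem gP_realPt_eq (h h' : Matrix (Fin g) (Fin g) ℂ) (t d : ℂ) (ht : t ^ 2 = -d) (B B' : E g →ₗ[ℂ] E g →ₗ[ℂ] ℂ)
    (hB : ∀ u v, B u v = bForm h' u v + t * bForm h u v) (hB' : ∀ u v, B' u v = bForm h' u v - t * bForm h u v)
    (f : Module.Dual ℂ (E g) × E g → Module.Dual ℂ (E g) × E g)
    (hf : ∀ z z' : E g, f (x₁ B z + x₁ B' z') = t • x₁ B z - t • x₁ B' z') (α₁ α₂ : Fin g → ℂ) :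
    pairV (f (IV J (x₁ B (realPt α₁ + Complex.I • realPt α₂) + x₁ B' (realPt α₁ - Complex.I • realPt α₂))))
        (x₁ B (realPt α₁ + Complex.I • realPt α₂) + x₁ B' (realPt α₁ - Complex.I • realPt α₂)) =
      -4 * d * (star (star α₁) ⬝ᵥ (h *ᵥ star α₁) + star (star α₂) ⬝ᵥ (h *ᵥ star α₂)) := by
  rw [gP_eq_realPoint J_J (bForm h') (bForm h) B B' t d ht hB hB' (bForm_alt h') (bForm_alt h) (bForm_J h') (bForm_J h)
    (realPt α₁) (realPt α₂) f hf, bForm_alt h (J (realPt α₁)), bForm_alt h (J (realPt α₂)), bForm_realPt_J, bForm_realPt_J]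
  ring

/-- **`h` positive definite ⇒ `g_P` negative at every non-zero real point** (`d > 0`): Markman's «`g_P` is negative definite»
(Prop. 2.4.4, there for `B = √-d·Θ`, `Θ` ample) holds for EVERY secant exponent `B = a + √-d·b` whose `b` has positive
definite Hermitian matrix — i.e. `(X × X̂, η_P, Ξ_P)` is polarised whenever `b` is a polarisation (paper dictionary).
[cite: Markman2025SecantWeil, §2.4 Prop. 2.4.4] -/
theorem gP_realPt_neg_of_posDef {h : Matrix (Fin g) (Fin g) ℂ} (hh : h.PosDef) (h' : Matrix (Fin g) (Fin g) ℂ) {t d : ℂ}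
    (ht : t ^ 2 = -d) (hd : 0 < d) (B B' : E g →ₗ[ℂ] E g →ₗ[ℂ] ℂ)
    (hB : ∀ u v, B u v = bForm h' u v + t * bForm h u v) (hB' : ∀ u v, B' u v = bForm h' u v - t * bForm h u v)
    (f : Module.Dual ℂ (E g) × E g → Module.Dual ℂ (E g) × E g)
    (hf : ∀ z z' : E g, f (x₁ B z + x₁ B' z') = t • x₁ B z - t • x₁ B' z') {α₁ α₂ : Fin g → ℂ} (hα : (α₁, α₂) ≠ 0) :
    pairV (f (IV J (x₁ B (realPt α₁ + Complex.I • realPt α₂) + x₁ B' (realPt α₁ - Complex.I • realPt α₂))))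
        (x₁ B (realPt α₁ + Complex.I • realPt α₂) + x₁ B' (realPt α₁ - Complex.I • realPt α₂)) < 0 := by
  rw [gP_realPt_eq h h' t d ht B B' hB hB' f hf α₁ α₂]
  have hps := hh.posSemidef
  have h1 : 0 ≤ star (star α₁) ⬝ᵥ (h *ᵥ star α₁) := hps.dotProduct_mulVec_nonneg _
  have h2 : 0 ≤ star (star α₂) ⬝ᵥ (h *ᵥ star α₂) := hps.dotProduct_mulVec_nonneg _
  have hsum : 0 < star (star α₁) ⬝ᵥ (h *ᵥ star α₁) + star (star α₂) ⬝ᵥ (h *ᵥ star α₂) := by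
    by_cases h0 : α₁ = 0
    · have hα₂ : α₂ ≠ 0 := fun h2' ↦ hα (by rw [h0, h2']; rfl)
      have := hh.dotProduct_mulVec_pos (x := star α₂) (fun e ↦ hα₂ (star_eq_zero.mp e))
      exact add_pos_of_nonneg_of_pos h1 this
    · have := hh.dotProduct_mulVec_pos (x := star α₁) (fun e ↦ h0 (star_eq_zero.mp e))
      exact add_pos_of_pos_of_nonneg this h2
  have h4 : (0 : ℂ) < 4 := by exact_mod_cast (by norm_num : (0 : ℝ) < 4)
  have key : -4 * d * (star (star α₁) ⬝ᵥ (h *ᵥ star α₁) + star (star α₂) ⬝ᵥ (h *ᵥ star α₂)) =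
      -(4 * d * (star (star α₁) ⬝ᵥ (h *ᵥ star α₁) + star (star α₂) ⬝ᵥ (h *ᵥ star α₂))) := by ring
  rw [key, neg_lt_zero]
  exact mul_pos (mul_pos h4 hd) hsum

/-- **Conversely: `g_P` negative at every non-zero real point ⇒ `h` positive definite** (`h` Hermitian, `d > 0`) — the
direction «`P` polarises `X × X̂` ⟹ `b` is a polarisation ⟹ (H1)» of ATTEMPT-1 §2 / S3INP-3, in the coordinate model (test the
real points with `α₂ = 0`). [cite: Markman2025SecantWeil, §2.4 Prop. 2.4.4] -/
theorem posDef_of_gP_realPt_neg {h : Matrix (Fin g) (Fin g) ℂ} (hh : h.IsHermitian) (h' : Matrix (Fin g) (Fin g) ℂ) {t d : ℂ}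
    (ht : t ^ 2 = -d) (hd : 0 < d) (B B' : E g →ₗ[ℂ] E g →ₗ[ℂ] ℂ)
    (hB : ∀ u v, B u v = bForm h' u v + t * bForm h u v) (hB' : ∀ u v, B' u v = bForm h' u v - t * bForm h u v)
    (f : Module.Dual ℂ (E g) × E g → Module.Dual ℂ (E g) × E g)
    (hf : ∀ z z' : E g, f (x₁ B z + x₁ B' z') = t • x₁ B z - t • x₁ B' z')
    (hneg : ∀ α₁ α₂ : Fin g → ℂ, (α₁, α₂) ≠ 0 →
      pairV (f (IV J (x₁ B (realPt α₁ + Complex.I • realPt α₂) + x₁ B' (realPt α₁ - Complex.I • realPt α₂))))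
        (x₁ B (realPt α₁ + Complex.I • realPt α₂) + x₁ B' (realPt α₁ - Complex.I • realPt α₂)) < 0) :
    h.PosDef := by
  rw [posDef_iff_bForm_realPt_pos hh]
  intro α hα
  have h1 := hneg α 0 (fun e ↦ hα (Prod.mk.inj e).1)
  rw [gP_realPt_eq h h' t d ht B B' hB hB' f hf α 0, star_zero, star_zero, zero_dotProduct, add_zero] at h1
  rw [bForm_realPt_J]
  -- `-4 d X < 0` with `d > 0` real forces `X > 0`
  obtain ⟨hdre, hdim⟩ := Complex.pos_iff.mp hd
  obtain ⟨r, rfl⟩ : ∃ r : ℝ, d = (r : ℂ) := ⟨d.re, Complex.ext rfl (by simpa using hdim.symm)⟩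
  rw [Complex.ofReal_re] at hdre
  have hinv : (0 : ℂ) < ((4 * r)⁻¹ : ℝ) := by exact_mod_cast (by positivity : (0 : ℝ) < (4 * r)⁻¹)
  have hpos : (0 : ℂ) < -(-4 * (r : ℂ) * (star (star α) ⬝ᵥ (h *ᵥ star α))) := neg_pos.mpr h1
  have key : star (star α) ⬝ᵥ (h *ᵥ star α) =
      (((4 * r)⁻¹ : ℝ) : ℂ) * -(-4 * (r : ℂ) * (star (star α) ⬝ᵥ (h *ᵥ star α))) := by
    have hr : (r : ℂ) ≠ 0 := by exact_mod_cast hdre.ne'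
    push_cast
    field_simp
  rw [key]
  exact mul_pos hinv hpos

end Dictionary

end SecantParity

end Summit.Ventures.HSemireg
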